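import Mathlib.LinearAlgebra.Matrix.Rank
import Mathlib.LinearAlgebra.Matrix.NonsingularInverse
import Literature.Computability.AlgebraicComplexity.Yab15BRank
import Literature.Computability.AlgebraicComplexity.DeterminantalComplexityProofs
import Literature.Computability.AlgebraicComplexity.CharpolyCoeffPowTrace
import Literature.Computability.AlgebraicComplexity.LandsbergRessayreNormalForm
import HarnessLib

/-!
# Yabe 2015, Lemma 2.8 and Lemma 5.1 — the normal forms of `p(x + x₀)` (proofs)

Topic `Literature/Computability/AlgebraicComplexity`; sibling proofs file of `Yab15BRank.lean`
(A. Yabe, *Bi-polynomial rank and determinantal complexity*, arXiv:1504.00151, typed by val-lit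
t17). This file DISCHARGES two of its named facts, the two normal forms on which the paper's
arguments rest:

* `yabe2015_lemma_2_8_holds` — **Lemma 2.8** (p0006): if `dc(p) = n` and `p(x₀) ≠ 0` then
  `p(x + x₀) = α · det(A(x) + I_n)` with `A` a matrix of homogeneous linear forms and `α ∈ K`
  (`α = det Q(x₀)`, `A = Q(x₀)⁻¹ L(x)`);
* `yabe2015_lemma_5_1_holds` — **Lemma 5.1** (p0011): if `dc(p) = n` and `p(x₀) = 0` then
  `p(x + x₀) = det(A(x) + Λ_n^r)` with `A` linear and `r ≤ n - 1` (`r = rank Q(x₀)`;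
  `S Q(x₀) T = Λ_n^r` with `det(ST) = 1`);
* `Yabe.bRank_one_quadraticPart_transl_le_determinantalComplexity` — **Theorem 1.5 for `k = 1`**
  (p0003): `brank(p_{x₀}^{(2)}) ≤ dc(p)` at a zero `x₀`, from Lemma 5.1 by Laplace expansion along
  the linear row `0` of `A + Λ_n^r` (the general `k` rests on Prop. 5.2, not proved here).

Common first step (`Yabe.exists_transl_eq_det`): from an affine representation `p = det Ã` of
size `n = dc(p)` (`hasDetRepr_determinantalComplexity_holds`), translating the variables
(`transl x₀`, `HessianAtOrigin.lean`) splits every affine entry as `Ã_{ij}(x + x₀) = Ã_{ij}(x₀) +`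
(a homogeneous linear form) (`PowTraceFromDetRepr.translate_affine`), so
`p(x + x₀) = det(Q + L(x))` with `Q = Ã(x₀) ∈ K^{n×n}`, `L` linear, and `det Q = p(x₀)`.
Lemma 2.8 is then `Q + L = Q (I + Q⁻¹ L)`. For Lemma 5.1, Mathlib's rank normal form
(`Matrix.exists_rank_normal_form`: `V Q U = [[1_r, 0], [0, 0]]` along some enumeration) is
conjugated by a permutation into the paper's `Λ_n^r = diag(0,…,0,1,…,1)` (`lambdaDiag`), and one
row of `V` is rescaled (a zero row of `Λ_n^r`, which exists as `r ≤ n - 1`) to achieve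
`det S · det T = 1`, so that `det(S (Q + L) T) = p(x + x₀)` on the nose.

Honest framing: bookkeeping of a published argument; nothing here bears on `VP ≠ VNP`.

## References

* [Yabe2015] A. Yabe, *Bi-polynomial rank and determinantal complexity*, arXiv:1504.00151 (2015),
  Lemma 2.8 (p. 6), Lemma 5.1 (p. 11).
-/

noncomputable section

open MvPolynomial Matrix Finset

namespace Literature.Computability.AlgebraicComplexity

universe u v

namespace Yabe

variable {K : Type u} [Field K] {σ : Type v}

/-- Translating an affine entry: `a(x + x₀) = a(x₀) + (its linear part)`, the linear part being
homogeneous of degree `1` (`PowTraceFromDetRepr.translate_affine` in the `transl` spelling).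
[cite: Yabe2015, §5 (p. 11, "linear polynomial matrix")] -/
theorem transl_eq_C_add_of_totalDegree_le_one [DecidableEq σ] (x₀ : σ → K) (a : MvPolynomial σ K)
    (ha : a.totalDegree ≤ 1) :
    transl x₀ a = C (eval x₀ a) + homogeneousComponent 1 (transl x₀ a) := by
  have h := PowTraceFromDetRepr.translate_affine x₀ a ha
  have e : (transl x₀ : MvPolynomial σ K →ₐ[K] MvPolynomial σ K) a =
      eval₂Hom C (fun v => X v + C (x₀ v)) a := by
    rw [transl, aeval_def, algebraMap_eq, coe_eval₂Hom]
  rw [e]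
  exact h

/-- `det (M.map C) = C (det M)` for a constant matrix viewed over the polynomial ring. [folklore] -/
private theorem det_map_C {n : Type*} [Fintype n] [DecidableEq n] (M : Matrix n n K) :
    (M.map (C : K →+* MvPolynomial σ K)).det = C M.det := by
  rw [RingHom.map_det, RingHom.mapMatrix_apply]

/-- A homogeneous linear form has no constant term. [folklore] -/
private theorem constantCoeff_eq_zero_of_isHomogeneous_one {q : MvPolynomial σ K} (hq : q.IsHomogeneous 1) :
    constantCoeff q = 0 :=
  hq.coeff_eq_zero (by simp)

/-- **The common first step of Yabe's Lemmas 2.8 and 5.1**: if `dc(p) = n` then for every point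
`x₀` there are a constant matrix `Q ∈ K^{n×n}` and a matrix `L` of homogeneous linear forms with
`p(x + x₀) = det(Q + L(x))` and `det Q = p(x₀)` (`Q = Ã(x₀)`, `L` = the linear part of the
translated optimal affine representation `Ã`). [cite: Yabe2015, Lemma 2.8 (proof)] -/
theorem exists_transl_eq_det [Fintype σ] [DecidableEq σ] (p : MvPolynomial σ K) (n : ℕ)
    (x₀ : σ → K) (hdc : determinantalComplexity p = n) :
    ∃ (Q : Matrix (Fin n) (Fin n) K) (L : Matrix (Fin n) (Fin n) (MvPolynomial σ K)),
      (∀ i j, (L i j).IsHomogeneous 1) ∧ transl x₀ p = (Q.map C + L).det ∧ Q.det = eval x₀ p := by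
  obtain ⟨A, hAdeg, hAdet⟩ := hdc ▸ hasDetRepr_determinantalComplexity_holds p
  refine ⟨Matrix.of fun i j => eval x₀ (A i j),
    Matrix.of fun i j => homogeneousComponent 1 (transl x₀ (A i j)),
    fun i j => homogeneousComponent_isHomogeneous 1 _, ?_, ?_⟩
  · -- `p(x + x₀) = det Ã(x + x₀)` and `Ã(x + x₀) = Q + L`
    have hmat : (transl x₀ : MvPolynomial σ K →ₐ[K] MvPolynomial σ K).toRingHom.mapMatrix A =
        (Matrix.of fun i j => eval x₀ (A i j)).map C +
          Matrix.of fun i j => homogeneousComponent 1 (transl x₀ (A i j)) :=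
      Matrix.ext fun i j => by
        simp only [RingHom.mapMatrix_apply, Matrix.map_apply, AlgHom.toRingHom_eq_coe,
          RingHom.coe_coe, Matrix.add_apply, Matrix.of_apply]
        exact transl_eq_C_add_of_totalDegree_le_one x₀ (A i j) (hAdeg i j)
    rw [← hmat, ← RingHom.map_det, hAdet]
    rfl
  · -- `det Q = p(x₀)`: compare constant terms
    have hc : constantCoeff (transl x₀ p) = eval x₀ p := constantCoeff_transl x₀ p
    have hmat : (transl x₀ : MvPolynomial σ K →ₐ[K] MvPolynomial σ K).toRingHom.mapMatrix A =
        (Matrix.of fun i j => eval x₀ (A i j)).map C +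
          Matrix.of fun i j => homogeneousComponent 1 (transl x₀ (A i j)) :=
      Matrix.ext fun i j => by
        simp only [RingHom.mapMatrix_apply, Matrix.map_apply, AlgHom.toRingHom_eq_coe,
          RingHom.coe_coe, Matrix.add_apply, Matrix.of_apply]
        exact transl_eq_C_add_of_totalDegree_le_one x₀ (A i j) (hAdeg i j)
    have hdet : transl x₀ p = ((Matrix.of fun i j => eval x₀ (A i j)).map C +
        Matrix.of fun i j => homogeneousComponent 1 (transl x₀ (A i j))).det := by
      rw [← hmat, ← RingHom.map_det, hAdet]; rfl
    rw [← hc, hdet, ← det_constPart]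
    congr 1
    refine Matrix.ext fun i j => ?_
    rw [constPart_apply, Matrix.add_apply, Matrix.map_apply, Matrix.of_apply, map_add,
      constantCoeff_C, Matrix.of_apply,
      constantCoeff_eq_zero_of_isHomogeneous_one (homogeneousComponent_isHomogeneous 1 _),
      add_zero]

/-- Entries of `S L T` (constant `S, T`, linear `L`) are homogeneous linear forms. [folklore] -/
private theorem isHomogeneous_one_conj {n : ℕ} (S T : Matrix (Fin n) (Fin n) K)
    {L : Matrix (Fin n) (Fin n) (MvPolynomial σ K)} (hL : ∀ i j, (L i j).IsHomogeneous 1)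
    (i j : Fin n) :
    ((S.map (C : K →+* MvPolynomial σ K) * L * T.map (C : K →+* MvPolynomial σ K)) i j).IsHomogeneous
      1 := by
  simp only [Matrix.mul_apply, Matrix.map_apply, Finset.sum_mul]
  refine IsHomogeneous.sum _ _ _ fun l _ => IsHomogeneous.sum _ _ _ fun m _ => ?_
  have h := ((isHomogeneous_C σ (S i m)).mul (hL m l)).mul (isHomogeneous_C σ (T l j))
  simpa using h

end Yabe

/-- **Yabe 2015, Lemma 2.8 — PROVED** (p0006): if `dc(p) = n` and `p(x₀) ≠ 0` then
`p(x + x₀) = α · det(A(x) + I)` for a matrix `A` of homogeneous linear forms and a scalar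
`α` (`= det Q(x₀) = p(x₀)`); `A = Q(x₀)⁻¹ L(x)` in the notation of `Yabe.exists_transl_eq_det`.
[cite: Yabe2015, Lemma 2.8] -/
theorem yabe2015_lemma_2_8_holds : yabe2015_lemma_2_8.{u, v} := by
  intro K _ σ _ _ p n x₀ hdc hne
  obtain ⟨Q, L, hL, hdet, hQ⟩ := Yabe.exists_transl_eq_det p n x₀ hdc
  have hQunit : IsUnit Q.det := isUnit_iff_ne_zero.2 (hQ ▸ hne)
  refine ⟨Q⁻¹.map C * L, Q.det, fun i j => ?_, ?_⟩
  · have h := Yabe.isHomogeneous_one_conj Q⁻¹ (1 : Matrix (Fin n) (Fin n) K) hL i j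
    simpa using h
  · have hsplit : Q.map C + L = Q.map C * (Q⁻¹.map (C : K →+* MvPolynomial σ K) * L + 1) := by
      rw [Matrix.mul_add, Matrix.mul_one, ← Matrix.mul_assoc, ← Matrix.map_mul,
        Matrix.mul_nonsing_inv Q hQunit, Matrix.map_one C C_0 C_1, Matrix.one_mul, add_comm]
    rw [hdet, hsplit, Matrix.det_mul, Yabe.det_map_C]

namespace Yabe

variable {K : Type u} [Field K]

/-- **Rank normal form in Yabe's shape**: a square matrix `Q` over a field with `det Q = 0`, of
rank `r` (so `r ≤ n - 1`), admits constant matrices `S, T` with `det S · det T = 1` and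
`S Q T = Λ_n^r` (Yabe 2015, proof of Lemma 5.1: "there exist nonsingular matrices
`S, T ∈ Mat_n(K)` satisfying `S Q(x₀) T = Λ_n^r` … `det(ST) = 1`"). [cite: Yabe2015, Lemma 5.1 (proof)] -/
theorem exists_mul_mul_eq_lambdaDiag {n : ℕ} (Q : Matrix (Fin n) (Fin n) K) (hQ : Q.det = 0) :
    ∃ S T : Matrix (Fin n) (Fin n) K, S.det * T.det = 1 ∧ Q.rank + 1 ≤ n ∧
      S * Q * T = lambdaDiag K n Q.rank := by
  classical
  have hrn : Q.rank + 1 ≤ n := by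
    have h := Matrix.rank_lt_card_of_det_eq_zero hQ
    rw [Fintype.card_fin] at h
    omega
  have hn : 0 < n := by omega
  obtain ⟨V, U, e, hV, hU, hVQU⟩ := Matrix.exists_rank_normal_form Q
  revert hrn e hVQU
  rw [Fintype.card_fin]
  generalize Q.rank = r
  intro hrn e hVQU
  -- the enumeration `Fin n → Fin r ⊕ Fin (n - r)` sending the LAST `r` indices to the left summand
  obtain ⟨g, hg₁, hg₂⟩ : ∃ g : Fin n → Fin r ⊕ Fin (n - r),
      (∀ i : Fin n, ∀ h : n - r ≤ (i : ℕ), g i = Sum.inl ⟨(i : ℕ) - (n - r), by omega⟩) ∧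
      (∀ i : Fin n, ∀ h : ¬ n - r ≤ (i : ℕ), g i = Sum.inr ⟨(i : ℕ), by omega⟩) :=
    ⟨fun i => if h : n - r ≤ (i : ℕ) then Sum.inl ⟨(i : ℕ) - (n - r), by omega⟩
      else Sum.inr ⟨(i : ℕ), by omega⟩, fun i h => dif_pos h, fun i h => dif_neg h⟩
  have hginj : Function.Injective g := by
    intro i j hij
    by_cases hi : n - r ≤ (i : ℕ) <;> by_cases hj : n - r ≤ (j : ℕ)
    · rw [hg₁ i hi, hg₁ j hj, Sum.inl.injEq, Fin.mk.injEq] at hij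
      exact Fin.ext (by omega)
    · rw [hg₁ i hi, hg₂ j hj] at hij; cases hij
    · rw [hg₂ i hi, hg₁ j hj] at hij; cases hij
    · rw [hg₂ i hi, hg₂ j hj, Sum.inr.injEq, Fin.mk.injEq] at hij
      exact Fin.ext hij
  have hgbij : Function.Bijective g :=
    (Fintype.bijective_iff_injective_and_card g).2 ⟨hginj, by simp; omega⟩
  -- `[[1_r, 0], [0, 0]]` pulled back along `g` is `Λ_n^r`
  have hΛ : (Matrix.fromBlocks (1 : Matrix (Fin r) (Fin r) K) 0 0
      (0 : Matrix (Fin (n - r)) (Fin (n - r)) K)).submatrix g g = lambdaDiag K n r := by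
    ext i j
    simp only [Matrix.submatrix_apply, lambdaDiag, Matrix.diagonal_apply]
    by_cases hi : n - r ≤ (i : ℕ) <;> by_cases hj : n - r ≤ (j : ℕ)
    · rw [hg₁ i hi, hg₁ j hj, Matrix.fromBlocks_apply₁₁, Matrix.one_apply, if_pos hi]
      by_cases hij : i = j
      · subst hij
        rw [if_pos rfl, if_pos rfl]
      · rw [if_neg hij, if_neg]
        intro h
        apply hij
        rw [Fin.ext_iff] at h ⊢
        simp only at h
        omega
    · have hij : i ≠ j := fun h => hj (h ▸ hi)
      rw [hg₁ i hi, hg₂ j hj, Matrix.fromBlocks_apply₁₂, Matrix.zero_apply, if_neg hij]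
    · have hij : i ≠ j := fun h => hi (h ▸ hj)
      rw [hg₂ i hi, hg₁ j hj, Matrix.fromBlocks_apply₂₁, Matrix.zero_apply, if_neg hij]
    · rw [hg₂ i hi, hg₂ j hj, Matrix.fromBlocks_apply₂₂, Matrix.zero_apply]
      by_cases hij : i = j
      · rw [if_pos hij, if_neg hi]
      · rw [if_neg hij]
  -- the permutation aligning `e` with `g`
  set π : Equiv.Perm (Fin n) := (Equiv.ofBijective g hgbij).trans e.symm with hπ
  have heπ : ∀ i, e (π i) = g i := fun i => by simp [hπ]
  have hperm : (V * Q * U).submatrix π π = lambdaDiag K n r := by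
    rw [hVQU, Matrix.submatrix_submatrix, show (e : Fin n → _) ∘ π = g from funext heπ]
    exact hΛ
  -- the rescaling of row `0` (a zero row of `Λ_n^r`)
  set c : K := V.det * U.det with hc
  have hc0 : c ≠ 0 := mul_ne_zero ((Matrix.isUnit_iff_isUnit_det V).1 hV).ne_zero
    ((Matrix.isUnit_iff_isUnit_det U).1 hU).ne_zero
  set d : Fin n → K := fun i => if i = ⟨0, hn⟩ then c⁻¹ else 1 with hd
  have hD : Matrix.diagonal d * lambdaDiag K n r = lambdaDiag K n r := by
    rw [lambdaDiag, Matrix.diagonal_mul_diagonal]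
    congr 1
    funext i
    by_cases hi : i = ⟨0, hn⟩
    · subst hi
      have : ¬ n - r ≤ ((⟨0, hn⟩ : Fin n) : ℕ) := by simp only; omega
      simp [this]
    · simp [hd, hi]
  refine ⟨Matrix.diagonal d * V.submatrix π id, U.submatrix id π, ?_, hrn, ?_⟩
  · rw [Matrix.det_mul, Matrix.det_diagonal, Matrix.det_permute, Matrix.det_permute',
      Finset.prod_ite_eq']
    simp only [Finset.mem_univ, ↓reduceIte]
    have hs : ((Equiv.Perm.sign π : ℤ) : K) * ((Equiv.Perm.sign π : ℤ) : K) = 1 := by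
      rw [← Int.cast_mul, ← Units.val_mul, Int.units_mul_self, Units.val_one, Int.cast_one]
    calc c⁻¹ * (↑(Equiv.Perm.sign π) * V.det) * (↑(Equiv.Perm.sign π) * U.det)
        = c⁻¹ * (V.det * U.det) * (((Equiv.Perm.sign π : ℤ) : K) * ((Equiv.Perm.sign π : ℤ) : K)) := by
          ring
      _ = 1 := by rw [hs, mul_one, ← hc, inv_mul_cancel₀ hc0]
  · rw [Matrix.mul_assoc (Matrix.diagonal d), Matrix.mul_assoc (Matrix.diagonal d), ← hD]
    -- `V_π Q U_π = (V Q U)_{π,π}` holds definitionally, so `hperm` closes the goal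
    exact congrArg (Matrix.diagonal d * ·) hperm

end Yabe

/-- **Yabe 2015, Lemma 5.1 — PROVED** (p0011): if `dc(p) = n` and `x₀ ∈ Zeros(p)` then
`p(x + x₀) = det(A(x) + Λ_n^r)` for a matrix `A` of homogeneous linear forms and some
`r ≤ n - 1` (`r = rank Q(x₀)`): with `Yabe.exists_transl_eq_det` (`p(x + x₀) = det(Q + L)`,
`det Q = p(x₀) = 0`) and `Yabe.exists_mul_mul_eq_lambdaDiag` (`S Q T = Λ_n^r`, `det S det T = 1`),
`A = S L T`. [cite: Yabe2015, Lemma 5.1] -/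
theorem yabe2015_lemma_5_1_holds : yabe2015_lemma_5_1.{u, v} := by
  intro K _ σ _ _ p n x₀ hdc hzero
  obtain ⟨Q, L, hL, hdet, hQ⟩ := Yabe.exists_transl_eq_det p n x₀ hdc
  rw [hzero] at hQ
  obtain ⟨S, T, hST, hr, hSQT⟩ := Yabe.exists_mul_mul_eq_lambdaDiag Q hQ
  refine ⟨S.map C * L * T.map C, Q.rank, Yabe.isHomogeneous_one_conj S T hL, hr, ?_⟩
  have hconj : S.map C * (Q.map C + L) * T.map C =
      S.map C * L * T.map C + (lambdaDiag K n Q.rank).map (C : K →+* MvPolynomial σ K) := by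
    rw [Matrix.mul_add, Matrix.add_mul, ← hSQT, Matrix.map_mul, Matrix.map_mul, add_comm]
  have hd : (S.map C * (Q.map C + L) * T.map (C : K →+* MvPolynomial σ K)).det = transl x₀ p := by
    rw [Matrix.det_mul, Matrix.det_mul, Yabe.det_map_C, Yabe.det_map_C, ← hdet,
      mul_comm (C S.det), mul_assoc, ← map_mul, hST, map_one, mul_one]
  rw [← hd, hconj]

namespace Yabe

variable {K : Type u} [Field K] {σ : Type v}

/-- Multiplying by a linear form shifts homogeneous components: `(f g)^{(2)} = f · g^{(1)}` for
`f` homogeneous of degree `1`. [folklore] -/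
private theorem homogeneousComponent_two_mul {f g : MvPolynomial σ K} (hf : f.IsHomogeneous 1) :
    homogeneousComponent 2 (f * g) = f * homogeneousComponent 1 g := by
  classical
  ext d
  rw [coeff_homogeneousComponent, coeff_mul, coeff_mul]
  have key : ∀ ab ∈ Finset.antidiagonal d,
      coeff ab.1 f * coeff ab.2 (homogeneousComponent 1 g) =
        if d.degree = 2 then coeff ab.1 f * coeff ab.2 g else 0 := by
    rintro ⟨a, b⟩ hab
    rw [Finset.mem_antidiagonal] at hab
    rw [coeff_homogeneousComponent]
    by_cases ha : a.degree = 1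
    · have hdb : d.degree = 1 + b.degree := by rw [← hab, map_add, ha]
      by_cases hb : b.degree = 1
      · rw [if_pos hb, if_pos (by rw [hdb, hb])]
      · rw [if_neg hb, if_neg (fun h => hb (by rw [hdb] at h; omega)), mul_zero]
    · simp only [hf.coeff_eq_zero ha, zero_mul, ite_self]
  rw [Finset.sum_congr rfl key]
  split_ifs with hd
  · rfl
  · simp

/-- **Yabe 2015, Theorem 1.5 in the case `k = 1` — PROVED**: for `x₀ ∈ Zeros(p)`,
`brank(p_{x₀}^{(2)}) ≤ dc(p)` (the printed bound `2^{-(2k-2)} brank − 2(k−1)D^{k−1}` at `k = 1`).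
Proof: by Lemma 5.1, `p(x + x₀) = det(A(x) + Λ_n^r)` with `r ≤ n − 1`, so row `0` of
`A + Λ_n^r` is linear; Laplace expansion along it writes the quadratic part as
`Σ_{j<n} (± A_{0j}) · (minor_j)^{(1)}` — `n` products of linear forms. (The general `k` needs the
paper's Prop. 5.2, not proved here.) [cite: Yabe2015, Theorem 1.5] -/
theorem bRank_one_quadraticPart_transl_le_determinantalComplexity [Fintype σ] [DecidableEq σ]
    (p : MvPolynomial σ K) (x₀ : σ → K) (hx : eval x₀ p = 0) :
    bRank 1 (homogeneousComponent 2 (transl x₀ p)) ≤ determinantalComplexity p := by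
  classical
  -- `n = dc(p) ≥ 1` (a zero exists), say `n = m + 1`
  have h₁ := yabe2015_lemma_5_1_holds K σ p (determinantalComplexity p) x₀ rfl hx
  obtain ⟨-, r₀, -, hr₀, -⟩ := h₁
  obtain ⟨m, hm⟩ : ∃ m, determinantalComplexity p = m + 1 :=
    ⟨determinantalComplexity p - 1, by omega⟩
  obtain ⟨A, r, hA, hr, hdet⟩ := yabe2015_lemma_5_1_holds K σ p (m + 1) x₀ hm hx
  rw [hm]
  obtain ⟨M, hM⟩ : ∃ M : Matrix (Fin (m + 1)) (Fin (m + 1)) (MvPolynomial σ K),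
      M = A + (lambdaDiag K (m + 1) r).map C := ⟨_, rfl⟩
  rw [← hM] at hdet
  -- row `0` of `Λ_n^r` vanishes (`r ≤ n - 1`), so row `0` of `M` is row `0` of `A`
  have hrow : ∀ j, M 0 j = A 0 j := fun j => by
    rw [hM, Matrix.add_apply, Matrix.map_apply, lambdaDiag, Matrix.diagonal_apply]
    have h0 : ¬ m + 1 - r ≤ ((0 : Fin (m + 1)) : ℕ) := by simp only [Fin.val_zero]; omega
    by_cases hj : (0 : Fin (m + 1)) = j
    · rw [if_pos hj, if_neg h0, map_zero, add_zero]
    · rw [if_neg hj, map_zero, add_zero]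
  have hf : ∀ j : Fin (m + 1), (C ((-1 : K) ^ (j : ℕ)) * A 0 j).IsHomogeneous 1 := fun j => by
    have h := (isHomogeneous_C σ ((-1 : K) ^ (j : ℕ))).mul (hA 0 j)
    rwa [zero_add] at h
  -- Laplace expansion along row `0`, then take the quadratic part
  have hexp : homogeneousComponent 2 (transl x₀ p) =
      ∑ j : Fin (m + 1), (C ((-1 : K) ^ (j : ℕ)) * A 0 j) *
        homogeneousComponent 1 (M.submatrix Fin.succ j.succAbove).det := by
    have hC : ∀ j : Fin (m + 1), ((-1 : MvPolynomial σ K) ^ (j : ℕ)) = C ((-1 : K) ^ (j : ℕ)) :=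
      fun j => by rw [map_pow, map_neg, map_one]
    rw [hdet, Matrix.det_succ_row_zero, map_sum]
    refine Finset.sum_congr rfl fun j _ => ?_
    rw [hrow, hC j, homogeneousComponent_two_mul (hf j)]
  calc bRank 1 (homogeneousComponent 2 (transl x₀ p)) ≤ Fintype.card (Fin (m + 1)) :=
        bRank_le_of_eq_sum (fun j : Fin (m + 1) => C ((-1 : K) ^ (j : ℕ)) * A 0 j)
          (fun j => homogeneousComponent 1 (M.submatrix Fin.succ j.succAbove).det) hf
          (fun j => homogeneousComponent_isHomogeneous 1 _) hexp
    _ = m + 1 := Fintype.card_fin _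

end Yabe

end Literature.Computability.AlgebraicComplexity

end
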